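import Summits.CriticalPhenomena.PercolationContinuityZ3.Theorems.PercNearOneGluingNoHeavyLowerTailLsmTwoCopy
import Summits.CriticalPhenomena.PercolationContinuityZ3.Theorems.PercNearOneGluingNoHeavyLowerTailSetSourceBHK
import HarnessLib

/-!
# `NoHeavyLowerTail` (crux stmt-CriticalPhenomena-4575), law-level frontier: the CONDITIONAL Gladkov–Zimin theorem
Support file (prover seat `prim-bnk-1` gen 14; `--supports stmt-CriticalPhenomena-4575`; no computation, no new definition).
THEOREM (`cgzCore`, finite-sum form in the language of `BHK2006.core`; memo
run/shared/lean/prim/prim-l12/FROM-prim-bnk-1-gen14-CONDITIONAL-GZ-PROVED.md §0–§2): for edge weights in `[0,1]` on a finite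
vertex type, `T ⊆ U`, `Y ⊆ U`, a monotone label `π` of edge sets into a preorder and a Gladkov–Zimin kernel `A`
(`A a d + A b c ≤ A a c + A b d` for `a ≤ b`, `c ≤ d`), with `ℓ ω = π(⋃_{t∈T} C_t^U(ω))` and `D = {T ↮ Y in G[U]}`:
`Σ_{ω,ω'} wt ω wt ω' 1_D(ω) 1_D(ω') A(ℓω, ℓω') ≤ (Σ_ω wt ω 1_D(ω)) · Σ_ω wt ω 1_D(ω) A(ℓω, ℓω)` — every GZ two-copy row
on the clusters of `T` survives conditioning on `{T ↮ Y}`.  `Y = ∅` is Gladkov–Zimin Thm. 2.3, `A = f ⊗ g` is BHK Thm. 1.3.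
Proof: strong induction on `U`; first-layer decomposition at `Y` in both copies (`step_sumSet₂`); the conditional two-copy
kernel `CE_X[CE_{X'}[A(ℓ·,ℓ·)]]` is cross-supermodular (`cker_cross`, from the stochastic monotonicity `ce_mono` =
`SetSourceBHK.coreSet`); the tilted first-layer weight `wt ζ · P(T ↮ S(ζ))` is log-supermodular (`coreSet`); Lemma A
(`LsmTwoCopy.lsm_twoCopy_le_set`) and the induction hypothesis on `U ∖ Y` finish.  The conditional-expectation functional
`CE_X` (fallback: the value at the empty configuration when `P(T ↮ X) = 0`) is a bound function with its defining equation.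
-/

namespace Summit.CriticalPhenomena.PercolationContinuityZ3.Theorems.ConditionalGZ

open Finset Literature.Probability.Percolation Literature.Probability.Percolation.BHK2006
open Literature.Probability.Percolation.DecisionTree (ind ind_of_mem ind_of_not_mem ind_nonneg)
open SetSourceBHK LsmTwoCopy
open scoped Classical

variable {V : Type*}

/-- BHK's first layer `S(ζ)` (vertices of `U ∖ Z` joined to `Z` by an open edge of `ζ`) is increasing in `ζ`. [this work] -/
theorem rS_mono (U Z : Finset V) : Monotone (rS U Z) :=
  fun _ _ h _ ⟨hn, z, hz, hze⟩ => ⟨hn, z, hz, h hze⟩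

/-- The union of the clusters of `T` in the EMPTY configuration is contained in every edge set (it is empty). [this work] -/
theorem rCT_empty_subset (U' T : Finset V) (a : Set (Sym2 V)) :
    (⋃ t ∈ T, rC U' t (∅ : Set (Sym2 V))) ⊆ a := by
  intro e he
  simp only [Set.mem_iUnion, rC, mem_openEdgeCluster_iff, Set.empty_inter,
    Set.mem_empty_iff_false, false_and, exists_false] at he

variable [Fintype V]

/-! ## The conditional-expectation functional `CE_X` and its monotonicity -/

/-- `h(X) = P(T ↮ X) ≥ 0`. [this work] -/
theorem h_nonneg (w : Sym2 V → ℝ) (hw0 : ∀ e, 0 ≤ w e) (hw1 : ∀ e, w e ≤ 1) (U' T : Finset V)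
    (h : Set V → ℝ) (hh : ∀ X, h X = ∑ ω, weight w ω * ind {ω | ∀ t ∈ T, ω ∈ rD U' t X} ω)
    (X : Set V) : 0 ≤ h X := by
  rw [hh]; exact Finset.sum_nonneg fun ω _ => mul_nonneg (weight_nonneg hw0 hw1 ω) (ind_nonneg _ _)

/-- `h` is antitone in `X`. [this work] -/
theorem h_antitone (w : Sym2 V → ℝ) (hw0 : ∀ e, 0 ≤ w e) (hw1 : ∀ e, w e ≤ 1) (U' T : Finset V)
    (h : Set V → ℝ) (hh : ∀ X, h X = ∑ ω, weight w ω * ind {ω | ∀ t ∈ T, ω ∈ rD U' t X} ω)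
    {X X' : Set V} (hXX' : X ⊆ X') : h X' ≤ h X := by
  rw [hh, hh]
  exact Finset.sum_le_sum fun ω _ => mul_le_mul_of_nonneg_left
    (ind_mono (rDT_antitone U' T hXX') ω) (weight_nonneg hw0 hw1 ω)

/-- The conditional-expectation functional `CE_X` is linear: `CE_X[φ₁ - φ₂] = CE_X[φ₁] - CE_X[φ₂]`. [this work] -/
theorem ce_sub (w : Sym2 V → ℝ) (U' T : Finset V) (h : Set V → ℝ)
    (ce : Set V → (Set (Sym2 V) → ℝ) → ℝ)
    (hce : ∀ X φ, ce X φ = if h X = 0 then φ ∅ else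
      (∑ ω, weight w ω * (φ ω * ind {ω | ∀ t ∈ T, ω ∈ rD U' t X} ω)) / h X)
    (X : Set V) (φ₁ φ₂ : Set (Sym2 V) → ℝ) :
    ce X (fun ω => φ₁ ω - φ₂ ω) = ce X φ₁ - ce X φ₂ := by
  rw [hce, hce, hce]
  split_ifs with h0
  · rfl
  · rw [← sub_div, ← Finset.sum_sub_distrib]
    congr 1
    exact Finset.sum_congr rfl fun ω _ => by ring

/-- **Stochastic monotonicity (memo (B2))**: for `X ⊆ X' ⊆ U'` and an antitone function `F` of the clusters of `T`,
`CE_X[F(C_T)] ≤ CE_{X'}[F(C_T)]` — the conditional law of `C_T` given `{T ↮ X}` is stochastically decreasing in `X`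
(from the set form of BHK Thm. 1.1, `SetSourceBHK.coreSet`; the fallback value `F(C_T(∅))` when `P(T↮X') = 0` is the
maximum of `F`). [this work] -/
theorem ce_mono (w : Sym2 V → ℝ) (hw0 : ∀ e, 0 ≤ w e) (hw1 : ∀ e, w e ≤ 1) (hm : ∑ ω, weight w ω = 1)
    (U' T : Finset V) (hTU' : T ⊆ U')
    (h : Set V → ℝ) (hh : ∀ X, h X = ∑ ω, weight w ω * ind {ω | ∀ t ∈ T, ω ∈ rD U' t X} ω)
    (ce : Set V → (Set (Sym2 V) → ℝ) → ℝ)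
    (hce : ∀ X φ, ce X φ = if h X = 0 then φ ∅ else
      (∑ ω, weight w ω * (φ ω * ind {ω | ∀ t ∈ T, ω ∈ rD U' t X} ω)) / h X)
    {X X' : Set V} (hXX' : X ⊆ X') (hX'U : X' ⊆ ↑U') (F : Set (Sym2 V) → ℝ) (hF : Antitone F) :
    ce X (fun ω => F (⋃ t ∈ T, rC U' t ω)) ≤ ce X' (fun ω => F (⋃ t ∈ T, rC U' t ω)) := by
  have hXU : X ⊆ ↑U' := hXX'.trans hX'U
  have hφle : ∀ ω : Set (Sym2 V), F (⋃ t ∈ T, rC U' t ω) ≤ F (⋃ t ∈ T, rC U' t ∅) :=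
    fun ω => hF (rCT_mono U' T (Set.empty_subset ω))
  have hXn := h_nonneg w hw0 hw1 U' T h hh X
  have hX'n := h_nonneg w hw0 hw1 U' T h hh X'
  have hXX'le := h_antitone w hw0 hw1 U' T h hh hXX'
  by_cases hX'0 : h X' = 0
  · rw [hce X', if_pos hX'0]
    by_cases hX0 : h X = 0
    · rw [hce X, if_pos hX0]
    · rw [hce X, if_neg hX0]
      have hXp : 0 < h X := lt_of_le_of_ne hXn (Ne.symm hX0)
      rw [div_le_iff₀ hXp, hh X, Finset.mul_sum]
      exact Finset.sum_le_sum fun ω _ => by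
        have := mul_le_mul_of_nonneg_right (hφle ω) (ind_nonneg {ω | ∀ t ∈ T, ω ∈ rD U' t X} ω)
        nlinarith [weight_nonneg hw0 hw1 ω, this]
  · have hX'p : 0 < h X' := lt_of_le_of_ne hX'n (Ne.symm hX'0)
    have hXp : 0 < h X := lt_of_lt_of_le hX'p hXX'le
    have hX0 : h X ≠ 0 := ne_of_gt hXp
    rw [hce X, hce X', if_neg hX0, if_neg hX'0, div_le_div_iff₀ hXp hX'p]
    -- BHK with `F₀ = F(∅-cluster) - F ≥ 0` increasing
    set c := F (⋃ t ∈ T, rC U' t ∅) with hc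
    have key := coreSet w hw0 hw1 hm U' T hTU' X' X hX'U hXU (fun C => c - F C)
      (fun a b hab => sub_le_sub_left (hF hab) c)
      (fun a => sub_nonneg.2 (hF (rCT_empty_subset U' T a)))
    rw [Set.inter_eq_right.2 hXX', Set.union_eq_left.2 hXX', ← hh X, ← hh X'] at key
    have e1 : ∀ Xx : Set V, ∑ ω, weight w ω * ((c - F (⋃ t ∈ T, rC U' t ω)) *
        ind {ω | ∀ t ∈ T, ω ∈ rD U' t Xx} ω) =
        c * h Xx - ∑ ω, weight w ω * (F (⋃ t ∈ T, rC U' t ω) * ind {ω | ∀ t ∈ T, ω ∈ rD U' t Xx} ω) := by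
      intro Xx
      rw [hh Xx, Finset.mul_sum, ← Finset.sum_sub_distrib]
      exact Finset.sum_congr rfl fun ω _ => by ring
    rw [e1 X', e1 X] at key
    nlinarith [key, mul_pos hXp hX'p]


/-! ## Cross-supermodularity of the conditional two-copy kernel -/

/-- **(ID) of the memo**: the conditional two-copy kernel `Ĝ(X,X') = CE_X[CE_{X'}[A(ℓ·,ℓ·)]]` is cross-supermodular on the
subsets of `U'`: `Ĝ(X₁,X₄) + Ĝ(X₂,X₃) ≤ Ĝ(X₁,X₃) + Ĝ(X₂,X₄)` for `X₁ ⊆ X₂`, `X₃ ⊆ X₄` (two applications of `ce_mono` and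
the kernel condition). [this work] -/
theorem cker_cross (w : Sym2 V → ℝ) (hw0 : ∀ e, 0 ≤ w e) (hw1 : ∀ e, w e ≤ 1) (hm : ∑ ω, weight w ω = 1)
    (U' T : Finset V) (hTU' : T ⊆ U')
    (h : Set V → ℝ) (hh : ∀ X, h X = ∑ ω, weight w ω * ind {ω | ∀ t ∈ T, ω ∈ rD U' t X} ω)
    (ce : Set V → (Set (Sym2 V) → ℝ) → ℝ)
    (hce : ∀ X φ, ce X φ = if h X = 0 then φ ∅ else
      (∑ ω, weight w ω * (φ ω * ind {ω | ∀ t ∈ T, ω ∈ rD U' t X} ω)) / h X)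
    {κ : Type*} [Preorder κ] (π : Set (Sym2 V) → κ) (hπ : Monotone π) (A : κ → κ → ℝ)
    (hA : ∀ a b c d : κ, a ≤ b → c ≤ d → A a d + A b c ≤ A a c + A b d)
    (G : Set V → Set V → ℝ)
    (hG : ∀ X X', G X X' = ce X (fun ω => ce X' (fun ω' =>
      A (π (⋃ t ∈ T, rC U' t ω)) (π (⋃ t ∈ T, rC U' t ω')))))
    {X₁ X₂ X₃ X₄ : Set V} (h12 : X₁ ⊆ X₂) (h2U : X₂ ⊆ ↑U') (h34 : X₃ ⊆ X₄) (h4U : X₄ ⊆ ↑U') :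
    G X₁ X₄ + G X₂ X₃ ≤ G X₁ X₃ + G X₂ X₄ := by
  -- step 1: for labels `a ≤ b`, `X' ↦ CE_{X'}[A a ℓ] - CE_{X'}[A b ℓ]` is monotone in `X'`
  have step1 : ∀ a b : κ, a ≤ b →
      ce X₃ (fun ω' => A a (π (⋃ t ∈ T, rC U' t ω'))) - ce X₃ (fun ω' => A b (π (⋃ t ∈ T, rC U' t ω'))) ≤
      ce X₄ (fun ω' => A a (π (⋃ t ∈ T, rC U' t ω'))) - ce X₄ (fun ω' => A b (π (⋃ t ∈ T, rC U' t ω'))) := by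
    intro a b hab
    rw [← ce_sub w U' T h ce hce, ← ce_sub w U' T h ce hce]
    exact ce_mono w hw0 hw1 hm U' T hTU' h hh ce hce h34 h4U (fun C => A a (π C) - A b (π C))
      (fun C C' hCC' => by
        have := hA a b (π C) (π C') hab (hπ hCC')
        show A a (π C') - A b (π C') ≤ A a (π C) - A b (π C)
        linarith)
  -- step 2: `ω ↦ CE_{X₄}[A(ℓω, ℓ·)] - CE_{X₃}[A(ℓω, ℓ·)]` is antitone, so `CE_{X₁}` of it is at most `CE_{X₂}` of it
  have mono : ce X₁ (fun ω => ce X₄ (fun ω' => A (π (⋃ t ∈ T, rC U' t ω)) (π (⋃ t ∈ T, rC U' t ω'))) -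
        ce X₃ (fun ω' => A (π (⋃ t ∈ T, rC U' t ω)) (π (⋃ t ∈ T, rC U' t ω')))) ≤
      ce X₂ (fun ω => ce X₄ (fun ω' => A (π (⋃ t ∈ T, rC U' t ω)) (π (⋃ t ∈ T, rC U' t ω'))) -
        ce X₃ (fun ω' => A (π (⋃ t ∈ T, rC U' t ω)) (π (⋃ t ∈ T, rC U' t ω')))) :=
    ce_mono w hw0 hw1 hm U' T hTU' h hh ce hce h12 h2U
      (fun C => ce X₄ (fun ω' => A (π C) (π (⋃ t ∈ T, rC U' t ω'))) -
        ce X₃ (fun ω' => A (π C) (π (⋃ t ∈ T, rC U' t ω'))))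
      (fun C C' hCC' => by
        have := step1 (π C) (π C') (hπ hCC')
        show ce X₄ (fun ω' => A (π C') (π (⋃ t ∈ T, rC U' t ω'))) -
            ce X₃ (fun ω' => A (π C') (π (⋃ t ∈ T, rC U' t ω'))) ≤
          ce X₄ (fun ω' => A (π C) (π (⋃ t ∈ T, rC U' t ω'))) -
            ce X₃ (fun ω' => A (π C) (π (⋃ t ∈ T, rC U' t ω')))
        linarith)
  rw [ce_sub w U' T h ce hce, ce_sub w U' T h ce hce, ← hG, ← hG, ← hG, ← hG] at mono
  linarith

/-! ## The first-layer decomposition in both copies -/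

/-- **Set form of BHK's identity (6) in two copies**: for `Z ⊆ W`, `Z ∩ T = ∅` and a function `Ψ` of the two clusters,
`E⊗E[Ψ(C_T,C_T') 1{T↮W} 1{T↮W}'] = Σ_{ζ,ζ'} wt ζ wt ζ' · E'⊗E'[Ψ(C_T,C_T') 1{T ↮ (W∖Z) ∪ S(ζ)} 1{T ↮ (W∖Z) ∪ S(ζ')}']` on
`G[U ∖ Z]`. [this work] -/
theorem step_sumSet₂ {U Z T : Finset V} (hZU : Z ⊆ U) (hTZ : ∀ t ∈ T, t ∉ Z) {W : Set V}
    (hZW : (↑Z : Set V) ⊆ W) (w : Sym2 V → ℝ) (hm : ∑ ω, weight w ω = 1)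
    (Ψ : Set (Sym2 V) → Set (Sym2 V) → ℝ) :
    ∑ ω, ∑ ω', weight w ω * weight w ω' * (Ψ (⋃ t ∈ T, rC U t ω) (⋃ t ∈ T, rC U t ω') *
        ind {ω | ∀ t ∈ T, ω ∈ rD U t W} ω * ind {ω | ∀ t ∈ T, ω ∈ rD U t W} ω') =
      ∑ ζ, ∑ ζ', weight w ζ * weight w ζ' * ∑ ω, ∑ ω', weight w ω * weight w ω' *
        (Ψ (⋃ t ∈ T, rC (U \ Z) t ω) (⋃ t ∈ T, rC (U \ Z) t ω') *
          ind {ω | ∀ t ∈ T, ω ∈ rD (U \ Z) t ((W \ ↑Z) ∪ rS U Z ζ)} ω *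
          ind {ω | ∀ t ∈ T, ω ∈ rD (U \ Z) t ((W \ ↑Z) ∪ rS U Z ζ')} ω') := by
  have s1 : ∀ H : Set (Sym2 V) → ℝ,
      ∑ ω, weight w ω * (H (⋃ t ∈ T, rC U t ω) * ind {ω | ∀ t ∈ T, ω ∈ rD U t W} ω) =
        ∑ ζ, weight w ζ * ∑ ω, weight w ω * (H (⋃ t ∈ T, rC (U \ Z) t ω) *
          ind {ω | ∀ t ∈ T, ω ∈ rD (U \ Z) t ((W \ ↑Z) ∪ rS U Z ζ)} ω) :=
    fun H => step_sumSet hZU hTZ hZW w hm H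
  set C : Set (Sym2 V) → Set (Sym2 V) := fun ω => ⋃ t ∈ T, rC U t ω with hC
  set C' : Set (Sym2 V) → Set (Sym2 V) := fun ω => ⋃ t ∈ T, rC (U \ Z) t ω with hC'
  set I : Set (Sym2 V) → ℝ := fun ω => ind {ω | ∀ t ∈ T, ω ∈ rD U t W} ω with hI
  set I' : Set (Sym2 V) → Set (Sym2 V) → ℝ := fun ζ ω =>
    ind {ω | ∀ t ∈ T, ω ∈ rD (U \ Z) t ((W \ ↑Z) ∪ rS U Z ζ)} ω with hI'
  have s1' : ∀ H : Set (Sym2 V) → ℝ, ∑ ω, weight w ω * (H (C ω) * I ω) =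
      ∑ ζ, weight w ζ * ∑ ω, weight w ω * (H (C' ω) * I' ζ ω) := fun H => s1 H
  show ∑ ω, ∑ ω', weight w ω * weight w ω' * (Ψ (C ω) (C ω') * I ω * I ω') =
    ∑ ζ, ∑ ζ', weight w ζ * weight w ζ' * ∑ ω, ∑ ω', weight w ω * weight w ω' *
      (Ψ (C' ω) (C' ω') * I' ζ ω * I' ζ' ω')
  have hinner : ∀ ω, ∑ ω', weight w ω * weight w ω' * (Ψ (C ω) (C ω') * I ω * I ω') =
      weight w ω * ((∑ ζ', weight w ζ' * ∑ ω', weight w ω' * (Ψ (C ω) (C' ω') * I' ζ' ω')) * I ω) := by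
    intro ω
    rw [← s1' (Ψ (C ω)), Finset.sum_mul, Finset.mul_sum]
    exact Finset.sum_congr rfl fun ω' _ => by ring
  rw [Finset.sum_congr rfl fun ω _ => hinner ω]
  -- outer copy, with `H C := Σ_ζ' wt ζ' Σ_ω' wt ω' Ψ(C, C' ω') I' ζ' ω'`
  rw [s1' (fun Cc => ∑ ζ', weight w ζ' * ∑ ω', weight w ω' * (Ψ Cc (C' ω') * I' ζ' ω'))]
  -- rearrange the finite sums: distribute all products into the sums, then swap `ω` and `ζ'`
  refine Finset.sum_congr rfl fun ζ _ => ?_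
  simp only [Finset.mul_sum, Finset.sum_mul]
  rw [Finset.sum_comm]
  exact Finset.sum_congr rfl fun ζ' _ => Finset.sum_congr rfl fun ω _ =>
    Finset.sum_congr rfl fun ω' _ => by ring

/-- Real-number bookkeeping for `bridge1` below: un-normalising a nested conditional expectation. [this work] -/
theorem alg_unnormalise {ι : Type*} [Fintype ι] (a b : ℝ) (ha : a ≠ 0) (hb : b ≠ 0) (wt I I' : ι → ℝ)
    (K : ι → ι → ℝ) :
    a * b * ((∑ ω, wt ω * ((∑ ω', wt ω' * (K ω ω' * I' ω')) / b * I ω)) / a) =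
      ∑ ω, ∑ ω', wt ω * wt ω' * (K ω ω' * I ω * I' ω') := by
  have h1 : ∀ S : ℝ, a * b * (S / a) = b * S := fun S => by field_simp
  rw [h1, Finset.mul_sum]
  refine Finset.sum_congr rfl fun ω _ => ?_
  have h2 : ∀ S : ℝ, b * (wt ω * (S / b * I ω)) = wt ω * (S * I ω) := fun S => by field_simp
  rw [h2, Finset.sum_mul, Finset.mul_sum]
  exact Finset.sum_congr rfl fun ω' _ => by ring

/-! ## The theorem -/

/-- **Conditional Gladkov–Zimin theorem (memo Theorem B), finite-sum form, percolation restricted to `U`.**  For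
`T ⊆ U`, `Y ⊆ U`, a monotone label `π` of edge sets into a preorder and a GZ kernel `A`
(`A a d + A b c ≤ A a c + A b d` for `a ≤ b`, `c ≤ d`), with `ℓ ω = π(⋃_{t∈T} C_t^U(ω))` and `D = {T ↮ Y in G[U]}`:
`Σ_{ω,ω'} wt ω wt ω' A(ℓω,ℓω') 1_D(ω) 1_D(ω') ≤ (Σ_ω wt ω 1_D(ω)) · Σ_ω wt ω A(ℓω,ℓω) 1_D(ω)`.
Strong induction on `U`: `Y = ∅` is Lemma A for the product weight (Gladkov–Zimin Thm. 2.3); otherwise condition on the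
first layer `S` around `Y` (`step_sumSet₂`), use Lemma A for the log-supermodular tilted weight `wt ζ · P(T↮S(ζ))`
(`coreSet`) and the cross-supermodular conditional kernel (`cker_cross`), and the induction hypothesis on `U ∖ Y`.
[this work] -/
theorem cgzCore (w : Sym2 V → ℝ) (hw0 : ∀ e, 0 ≤ w e) (hw1 : ∀ e, w e ≤ 1) (hm : ∑ ω, weight w ω = 1)
    {κ : Type*} [Preorder κ] (π : Set (Sym2 V) → κ) (hπ : Monotone π) (A : κ → κ → ℝ)
    (hA : ∀ a b c d : κ, a ≤ b → c ≤ d → A a d + A b c ≤ A a c + A b d) (U : Finset V) :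
    ∀ (T : Finset V), T ⊆ U → ∀ (Y : Set V), Y ⊆ ↑U →
    ∑ ω, ∑ ω', weight w ω * weight w ω' *
        (A (π (⋃ t ∈ T, rC U t ω)) (π (⋃ t ∈ T, rC U t ω')) *
          ind {ω | ∀ t ∈ T, ω ∈ rD U t Y} ω * ind {ω | ∀ t ∈ T, ω ∈ rD U t Y} ω') ≤
      (∑ ω, weight w ω * ind {ω | ∀ t ∈ T, ω ∈ rD U t Y} ω) *
        ∑ ω, weight w ω * (A (π (⋃ t ∈ T, rC U t ω)) (π (⋃ t ∈ T, rC U t ω)) *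
          ind {ω | ∀ t ∈ T, ω ∈ rD U t Y} ω) := by
  induction U using Finset.strongInduction with
  | H U ih =>
  intro T hTU Y hYU
  by_cases hTY : ∃ t ∈ T, t ∈ Y
  · obtain ⟨t, htT, htY⟩ := hTY
    have h0 : ∀ ω : Set (Sym2 V), ind {ω : Set (Sym2 V) | ∀ t ∈ T, ω ∈ rD U t Y} ω = 0 := fun ω => by
      rw [rDT_eq_empty htT htY, ind_of_not_mem (Set.notMem_empty ω)]
    simp only [h0, mul_zero, Finset.sum_const_zero, le_refl]
  simp only [not_exists, not_and] at hTY
  set Z : Finset V := U.filter fun v => v ∈ Y with hZ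
  have hZU : Z ⊆ U := Finset.filter_subset _ _
  have hmemZ : ∀ v, v ∈ Z ↔ v ∈ Y := fun v => by
    simp only [hZ, Finset.mem_filter, and_iff_right_iff_imp]; exact fun hv => hYU hv
  have hTZ : ∀ t ∈ T, t ∉ Z := fun t ht htZ => hTY t ht ((hmemZ t).1 htZ)
  -- the two-copy kernel on configurations is cross-supermodular (used in both cases)
  have hgU : ∀ (U₀ : Finset V) ⦃x y z t : Set (Sym2 V)⦄, x ⊆ y → z ⊆ t →
      A (π (⋃ s ∈ T, rC U₀ s x)) (π (⋃ s ∈ T, rC U₀ s t)) + A (π (⋃ s ∈ T, rC U₀ s y)) (π (⋃ s ∈ T, rC U₀ s z)) ≤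
      A (π (⋃ s ∈ T, rC U₀ s x)) (π (⋃ s ∈ T, rC U₀ s z)) + A (π (⋃ s ∈ T, rC U₀ s y)) (π (⋃ s ∈ T, rC U₀ s t)) :=
    fun U₀ x y z t hxy hzt => hA _ _ _ _ (hπ (rCT_mono U₀ T hxy)) (hπ (rCT_mono U₀ T hzt))
  rcases Z.eq_empty_or_nonempty with hZe | hZne
  · /- `Y = ∅`: Lemma A for the (log-modular) product weight = Gladkov–Zimin Thm. 2.3. -/
    have h1 : ∀ ω : Set (Sym2 V), ind {ω : Set (Sym2 V) | ∀ t ∈ T, ω ∈ rD U t Y} ω = 1 := fun ω =>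
      ind_of_mem fun t _ y hy _ => by
        have : y ∈ Z := (hmemZ y).2 hy
        rw [hZe] at this; exact absurd this (Finset.notMem_empty y)
    simp only [h1, mul_one]
    exact lsm_twoCopy_le_set (weight w) (weight_nonneg hw0 hw1)
      (fun s t => (weight_inter_mul_union w s t).le) _ (hgU U)
  · /- `Y ≠ ∅`: first-layer decomposition, Lemma A for the tilted weight, induction hypothesis on `U ∖ Z`. -/
    have hss : U \ Z ⊂ U := Finset.sdiff_ssubset hZU hZne
    have hTU' : T ⊆ U \ Z := fun t ht => Finset.mem_sdiff.2 ⟨hTU ht, hTZ t ht⟩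
    have hZY : (↑Z : Set V) ⊆ Y := fun v hv => (hmemZ v).1 hv
    have hYZ : ∀ S : Set V, (Y \ ↑Z) ∪ S = S := fun S => by
      have : Y \ ↑Z = ∅ := Set.eq_empty_of_forall_notMem fun v ⟨hvY, hvZ⟩ =>
        hvZ (Finset.mem_coe.2 ((hmemZ v).2 hvY))
      rw [this, Set.empty_union]
    set U' := U \ Z with hU'
    have eL := step_sumSet₂ hZU hTZ hZY w hm (fun C C' => A (π C) (π C'))
    have eR1 : ∑ ω, weight w ω * ind {ω | ∀ t ∈ T, ω ∈ rD U t Y} ω =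
        ∑ ζ, weight w ζ * ∑ ω, weight w ω * ind {ω | ∀ t ∈ T, ω ∈ rD U' t (rS U Z ζ)} ω := by
      have := step_sumSet hZU hTZ hZY w hm (fun _ => 1)
      simp only [one_mul, hYZ] at this; exact this
    have eR2 := step_sumSet hZU hTZ hZY w hm (fun C => A (π C) (π C))
    simp only [hYZ] at eL eR2
    rw [eL, eR1, eR2]
    set h : Set V → ℝ := fun X => ∑ ω, weight w ω * ind {ω | ∀ t ∈ T, ω ∈ rD U' t X} ω with hh
    have hh' : ∀ X, h X = ∑ ω, weight w ω * ind {ω | ∀ t ∈ T, ω ∈ rD U' t X} ω := fun X => rfl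
    set ce : Set V → (Set (Sym2 V) → ℝ) → ℝ := fun X φ => if h X = 0 then φ ∅ else
      (∑ ω, weight w ω * (φ ω * ind {ω | ∀ t ∈ T, ω ∈ rD U' t X} ω)) / h X with hce
    have hce' : ∀ X φ, ce X φ = if h X = 0 then φ ∅ else
      (∑ ω, weight w ω * (φ ω * ind {ω | ∀ t ∈ T, ω ∈ rD U' t X} ω)) / h X := fun X φ => rfl
    set ℓ : Set (Sym2 V) → κ := fun ω => π (⋃ t ∈ T, rC U' t ω) with hℓ
    set G : Set V → Set V → ℝ := fun X X' => ce X (fun ω => ce X' (fun ω' => A (ℓ ω) (ℓ ω'))) with hGdef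
    have hG' : ∀ X X', G X X' = ce X (fun ω => ce X' (fun ω' =>
      A (π (⋃ t ∈ T, rC U' t ω)) (π (⋃ t ∈ T, rC U' t ω')))) := fun X X' => rfl
    set Q : Set V → Set V → ℝ := fun X X' => ∑ ω, ∑ ω', weight w ω * weight w ω' *
      (A (ℓ ω) (ℓ ω') * ind {ω | ∀ t ∈ T, ω ∈ rD U' t X} ω * ind {ω | ∀ t ∈ T, ω ∈ rD U' t X'} ω') with hQ
    set Δ : Set V → ℝ := fun X => ∑ ω, weight w ω * (A (ℓ ω) (ℓ ω) * ind {ω | ∀ t ∈ T, ω ∈ rD U' t X} ω) with hΔ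
    show ∑ ζ, ∑ ζ', weight w ζ * weight w ζ' * Q (rS U Z ζ) (rS U Z ζ') ≤
      (∑ ζ, weight w ζ * h (rS U Z ζ)) * ∑ ζ, weight w ζ * Δ (rS U Z ζ)
    have hn : ∀ X, 0 ≤ h X := h_nonneg w hw0 hw1 U' T h hh'
    -- `h X = 0` kills every term carrying `1{T↮X}`
    have hkill : ∀ X, h X = 0 → ∀ ω, weight w ω * ind {ω | ∀ t ∈ T, ω ∈ rD U' t X} ω = 0 :=
      fun X hX0 ω => (Finset.sum_eq_zero_iff_of_nonneg (fun ω _ => mul_nonneg (weight_nonneg hw0 hw1 ω)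
        (ind_nonneg {ω | ∀ t ∈ T, ω ∈ rD U' t X} ω))).1 hX0 ω (Finset.mem_univ ω)
    -- bridge 1: `h X · h X' · G X X' = Q X X'`
    have bridge1 : ∀ X X', h X * h X' * G X X' = Q X X' := by
      intro X X'
      by_cases hX0 : h X = 0
      · rw [hX0, zero_mul, zero_mul, hQ]
        refine Eq.symm (Finset.sum_eq_zero fun ω _ => Finset.sum_eq_zero fun ω' _ => by
          have := hkill X hX0 ω
          calc weight w ω * weight w ω' * (A (ℓ ω) (ℓ ω') * ind {ω | ∀ t ∈ T, ω ∈ rD U' t X} ω *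
                ind {ω | ∀ t ∈ T, ω ∈ rD U' t X'} ω')
              = (weight w ω * ind {ω | ∀ t ∈ T, ω ∈ rD U' t X} ω) *
                (weight w ω' * A (ℓ ω) (ℓ ω') * ind {ω | ∀ t ∈ T, ω ∈ rD U' t X'} ω') := by ring
            _ = 0 := by rw [this, zero_mul])
      by_cases hX'0 : h X' = 0
      · rw [hX'0, mul_zero, zero_mul, hQ]
        refine Eq.symm (Finset.sum_eq_zero fun ω _ => Finset.sum_eq_zero fun ω' _ => by
          have := hkill X' hX'0 ω'
          calc weight w ω * weight w ω' * (A (ℓ ω) (ℓ ω') * ind {ω | ∀ t ∈ T, ω ∈ rD U' t X} ω *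
                ind {ω | ∀ t ∈ T, ω ∈ rD U' t X'} ω')
              = (weight w ω' * ind {ω | ∀ t ∈ T, ω ∈ rD U' t X'} ω') *
                (weight w ω * A (ℓ ω) (ℓ ω') * ind {ω | ∀ t ∈ T, ω ∈ rD U' t X} ω) := by ring
            _ = 0 := by rw [this, zero_mul])
      have e1 : G X X' = (∑ ω, weight w ω * ((ce X' fun ω' => A (ℓ ω) (ℓ ω')) *
          ind {ω | ∀ t ∈ T, ω ∈ rD U' t X} ω)) / h X := by
        simp only [hGdef, hce, hX0, if_false]
      have e2 : ∀ ω, ce X' (fun ω' => A (ℓ ω) (ℓ ω')) = (∑ ω', weight w ω' * (A (ℓ ω) (ℓ ω') *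
          ind {ω | ∀ t ∈ T, ω ∈ rD U' t X'} ω')) / h X' := fun ω => by
        simp only [hce, hX'0, if_false]
      rw [e1]; simp only [e2]
      exact alg_unnormalise (h X) (h X') hX0 hX'0 (weight w)
        (fun ω => ind {ω | ∀ t ∈ T, ω ∈ rD U' t X} ω) (fun ω' => ind {ω | ∀ t ∈ T, ω ∈ rD U' t X'} ω')
        (fun ω ω' => A (ℓ ω) (ℓ ω'))
    -- bridge 2: `h X · G X X ≤ Δ X` (the induction hypothesis on `U'`)
    have bridge2 : ∀ X, X ⊆ ↑U' → h X * G X X ≤ Δ X := by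
      intro X hXU'
      by_cases hX0 : h X = 0
      · rw [hX0, zero_mul, hΔ]
        exact le_of_eq (Finset.sum_eq_zero fun ω _ => by
          have := hkill X hX0 ω
          calc weight w ω * (A (ℓ ω) (ℓ ω) * ind {ω | ∀ t ∈ T, ω ∈ rD U' t X} ω)
              = (weight w ω * ind {ω | ∀ t ∈ T, ω ∈ rD U' t X} ω) * A (ℓ ω) (ℓ ω) := by ring
            _ = 0 := by rw [this, zero_mul]).symm
      have hXp : 0 < h X := lt_of_le_of_ne (hn X) (Ne.symm hX0)
      have IH := ih U' hss T hTU' X hXU'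
      have hQIH : Q X X ≤ h X * Δ X := IH
      have e : h X * G X X = Q X X / h X := by
        rw [eq_div_iff hX0, ← bridge1 X X]; ring
      rw [e, div_le_iff₀ hXp, mul_comm]
      exact hQIH
    -- Lemma A for the tilted first-layer weight
    have hSsub : ∀ ζ : Set (Sym2 V), rS U Z ζ ⊆ ↑U' := fun ζ => rS_subset U Z ζ
    have hLSM : ∀ X X' : Set V, X ⊆ ↑U' → X' ⊆ ↑U' → h X * h X' ≤ h (X ∩ X') * h (X ∪ X') := by
      intro X X' hXU hX'U
      have := coreSet w hw0 hw1 hm U' T hTU' X X' hXU hX'U (fun _ => 1) (fun _ _ _ => le_rfl)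
        (fun _ => zero_le_one)
      simp only [one_mul] at this
      exact this
    have LA := lsm_twoCopy_le_set (fun ζ => weight w ζ * h (rS U Z ζ))
      (fun ζ => mul_nonneg (weight_nonneg hw0 hw1 ζ) (hn _))
      (fun ζ ζ' => by
        have hw := weight_inter_mul_union w ζ ζ'
        have h1 := hLSM (rS U Z ζ) (rS U Z ζ') (hSsub ζ) (hSsub ζ')
        have h2 : h (rS U Z ζ ∩ rS U Z ζ') ≤ h (rS U Z (ζ ∩ ζ')) :=
          h_antitone w hw0 hw1 U' T h hh' (rS_inter_subset U Z ζ ζ')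
        have h3 : h (rS U Z ζ ∪ rS U Z ζ') = h (rS U Z (ζ ∪ ζ')) := by rw [rS_union]
        calc weight w ζ * h (rS U Z ζ) * (weight w ζ' * h (rS U Z ζ'))
            = (weight w ζ * weight w ζ') * (h (rS U Z ζ) * h (rS U Z ζ')) := by ring
          _ ≤ (weight w (ζ ∩ ζ') * weight w (ζ ∪ ζ')) * (h (rS U Z (ζ ∩ ζ')) * h (rS U Z (ζ ∪ ζ'))) := by
              rw [hw]
              refine mul_le_mul_of_nonneg_left (h1.trans ?_)
                (mul_nonneg (weight_nonneg hw0 hw1 _) (weight_nonneg hw0 hw1 _))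
              rw [← h3]
              exact mul_le_mul_of_nonneg_right h2 (hn _)
          _ = weight w (ζ ∩ ζ') * h (rS U Z (ζ ∩ ζ')) * (weight w (ζ ∪ ζ') * h (rS U Z (ζ ∪ ζ'))) := by ring)
      (fun ζ ζ' => G (rS U Z ζ) (rS U Z ζ'))
      (fun x y z t hxy hzt => cker_cross w hw0 hw1 hm U' T hTU' h hh' ce hce' π hπ A hA G hG'
        (rS_mono U Z hxy) (hSsub y) (rS_mono U Z hzt) (hSsub t))
    have eLHS : ∑ ζ, ∑ ζ', weight w ζ * weight w ζ' * Q (rS U Z ζ) (rS U Z ζ') =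
        ∑ ζ, ∑ ζ', weight w ζ * h (rS U Z ζ) * (weight w ζ' * h (rS U Z ζ')) * G (rS U Z ζ) (rS U Z ζ') :=
      Finset.sum_congr rfl fun ζ _ => Finset.sum_congr rfl fun ζ' _ => by
        rw [← bridge1]; ring
    rw [eLHS]
    refine LA.trans (mul_le_mul_of_nonneg_left ?_ (Finset.sum_nonneg fun ζ _ =>
      mul_nonneg (weight_nonneg hw0 hw1 ζ) (hn _)))
    exact Finset.sum_le_sum fun ζ _ => by
      have := bridge2 (rS U Z ζ) (hSsub ζ)
      calc weight w ζ * h (rS U Z ζ) * G (rS U Z ζ) (rS U Z ζ)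
          = weight w ζ * (h (rS U Z ζ) * G (rS U Z ζ) (rS U Z ζ)) := by ring
        _ ≤ weight w ζ * Δ (rS U Z ζ) := mul_le_mul_of_nonneg_left this (weight_nonneg hw0 hw1 ζ)

end Summit.CriticalPhenomena.PercolationContinuityZ3.Theorems.ConditionalGZ
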